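import Literature.NumberTheory.PAdicHodge.AinfRamifiedOmegaPeriodNonvanishing
import HarnessLib

/-!
# (L2″)/(N1″) over a ramified base with `e < p`: the THREE-term supersingular shape `[p] = p·X·R + ϖ·X^p·H + X^{p²}·S`

Topic `Literature/NumberTheory/PAdicHodge`; THEOREMS ONLY. Sequel of `AinfRamifiedVarpi` (the `ϖ`-adic descent lemma for the
TWO-term shape `p·T·R = T^N·S`), `AinfRamifiedPTorsionZero` (L2′) and `AinfRamifiedOmegaPeriodNonvanishing` (N1′).

CAVEAT REPAIRED HERE. Over a RAMIFIED base `𝒪_D = ℤ_p[ϖ]` (`e > 1`) the multiplication-by-`p` series of a Weierstrass equation with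
good supersingular reduction does NOT in general have the two-term shape of the unramified case: by Silverman AEC IV.4.4
(`[p] = p f + g(X^p)`) the coefficients of `X^j`, `p ∤ j`, lie in `p𝒪_D`, but the coefficients of `X^{pi}`, `0 < i < p`, are only
known to lie in `ϖ𝒪_D` (they vanish modulo `ϖ` because the reduction has height `2`, `[p]~ = G̃(X^{p²})`). The honest shape is

  `[p](X) = p·X·R(X) + ϖ·X^p·H(X) + X^{p²}·S(X)`,   `R(0), S(0) ∈ 𝒪_Dˣ`, `H ∈ 𝒪_D⟦X⟧` arbitrary

(when `ϖ ∤ H(0)` the formal group has a canonical subgroup — cf. `Lines/kato-lever-hDR-R1-torsion-witness.md`). This file proves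
that for **tame ramification `e < p`** the extra term is harmless:

* §1 **`AinfRam.eq_zero_of_three_term`** — the `ϖ`-adic descent for `p·T·R + ϖ·T^p·G + T^N·S = 0` (`R`, `S` units, `G` arbitrary,
  `e < p`, `e + 2 ≤ N`): `T = 0`. (At level `T = ϖ^k T'`, `k ≥ 1`, the `p`-term `ϖ^{e+k}` strictly dominates the middle term
  `ϖ^{1+kp}` exactly when `e - 1 < k(p-1)`, which `e < p` guarantees for every `k ≥ 1`.)
* §2 **`eq_zero_of_mulP_eq_zero_of_lt`** (L2″) — under the three-term shape and `e < p`, `[p]T = 0 ⟹ T = 0` on `Ŵ(𝔫_𝒪)`;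
* §3 **`omegaPeriod_ne_zero_of_seq_one_ne_zero_of_lt`** (N1″) — under the three-term shape and `e < p`, `∫_t ω ≠ 0` whenever
  `t₀ = 0`, `t₁ ≠ 0`.

For the K★ cells: `(5; IV*)` has `e = 3 < 5`, `(7; III*)` has `e = 4 < 7` — covered; `(5; II*)` has `e = 6 > 5` — NOT covered
(there the level `k = 1` is dominated by the middle term and the canonical subgroup intervenes; the witness `t` must be chosen with
`t₁` outside it — coefficient side). No definitions, no named facts, no `sorry`. Nothing about elliptic curves over number fields is
proved here; BSD is not proved by any of this.

## References
* J. H. Silverman, *The Arithmetic of Elliptic Curves* (2009), IV.4.4, IV.7.5. [SilvermanAEC2009]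
* L. Fargues, J.-M. Fontaine, Astérisque 406 (2018), §2.2. [FarguesFontaine2018]
* J.-M. Fontaine, *Formes différentielles et modules de Tate…*, Invent. Math. 65 (1982), §5. [Fontaine1982FormesDifferentielles]
-/

noncomputable section

open Ideal Field ValuativeRel

namespace Literature.NumberTheory.PAdicHodge

open Literature.NumberTheory.GaloisRepresentations
open Literature.NumberTheory.GaloisRepresentations.IsNonarchimedeanLocalField
open Literature.NumberTheory.GaloisRepresentations.LubinTate

variable {F : Type} [Field F] [ValuativeRel F] [TopologicalSpace F] [IsNonarchimedeanLocalField F] [CharZero F]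
  {p : ℕ} [Fact p.Prime] [Fact (¬ IsUnit (p : integerC F))] [IsAdicComplete (Ideal.span {(p : integerC F)}) (integerC F)]
  {hp : valuation F p < 1}

/-! ## §1 The `ϖ`-adic descent for the three-term shape (`e < p`) -/

namespace AinfRam

variable (D : EisensteinRoot F p hp)

/-- **Three-term `ϖ`-adic descent (tame case `e < p`)**: if `p·T·R + ϖ·T^p·G + T^N·S = 0` in `A_inf(𝒪)` with `R`, `S` units,
`G` arbitrary, `e < p` and `e + 2 ≤ N`, then `ϖ^k ∣ T` for every `k`. Step `k = 0`: `T^N S ∈ ϖA ⇒ ϖ ∣ T`. Step `k ≥ 1`,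
`T = ϖ^k T'`, `p = ϖ^e v`: cancelling `ϖ^{e+k}` leaves `v T' R = -ϖ^{1+kp-e-k}(…) - ϖ^{kN-e-k}(…) ∈ ϖA` since `e - 1 < k(p - 1)`.
[cite: FarguesFontaine2018, §2.2] [cite: SilvermanAEC2009, IV.7.5] -/
theorem varpi_pow_dvd_of_three_term (hF : Function.Surjective (WittVector.fontaineTheta (integerC F) p))
    {T R G S : AinfRam D} (hR : IsUnit R) (hS : IsUnit S) (he : D.e < p) {N : ℕ} (hN : D.e + 2 ≤ N)
    (h : (p : AinfRam D) * T * R + varpi D * T ^ p * G + T ^ N * S = 0) : ∀ k : ℕ, varpi D ^ k ∣ T := by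
  haveI := isDomain D hF
  obtain ⟨v, hv⟩ := exists_unit_natCast_eq_varpi_pow_mul D
  have hp1 : 1 ≤ p := (Fact.out : p.Prime).one_lt.le
  intro k
  induction k with
  | zero => rw [pow_zero]; exact one_dvd _
  | succ k ih =>
    obtain ⟨T', rfl⟩ := ih
    rcases Nat.eq_zero_or_pos k with rfl | hk
    · -- `T^N S = -(p T R + ϖ T^p G) ∈ ϖ A`
      rw [pow_zero, one_mul] at *
      rw [zero_add, pow_one]
      refine varpi_dvd_of_varpi_dvd_pow D (n := N) ((hS.dvd_mul_right).1 ?_)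
      have h' : T' ^ N * S = -((p : AinfRam D) * T' * R + varpi D * T' ^ p * G) := by linear_combination h
      rw [h']
      refine (dvd_neg).2 (dvd_add ?_ ?_)
      · rw [mul_assoc]; exact (varpi_dvd_natCast D).mul_right _
      · rw [mul_assoc]; exact dvd_mul_right _ _
    · -- exponents: `e + k` (p-term) < `1 + k p` (middle) and < `k N` (last)
      have hle1 : k + D.e + 1 ≤ k * p + 1 := by nlinarith
      have hle2 : k + D.e + 1 ≤ k * N := by nlinarith
      obtain ⟨m1, hm1⟩ := Nat.exists_eq_add_of_le hle1
      obtain ⟨m2, hm2⟩ := Nat.exists_eq_add_of_le hle2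
      have hp' : (p : AinfRam D) * (varpi D ^ k * T') * R = varpi D ^ (k + D.e) * ((v : AinfRam D) * T' * R) := by
        rw [hv]; ring
      have hG' : varpi D * (varpi D ^ k * T') ^ p * G = varpi D ^ (k + D.e) * (varpi D ^ (m1 + 1) * T' ^ p * G) := by
        rw [mul_pow, ← pow_mul, ← mul_assoc, ← pow_succ', hm1]; ring
      have hS' : (varpi D ^ k * T') ^ N * S = varpi D ^ (k + D.e) * (varpi D ^ (m2 + 1) * T' ^ N * S) := by
        rw [mul_pow, ← pow_mul, hm2]; ring
      have h1 : varpi D ^ (k + D.e) * ((v : AinfRam D) * T' * R + varpi D ^ (m1 + 1) * T' ^ p * G +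
          varpi D ^ (m2 + 1) * T' ^ N * S) = varpi D ^ (k + D.e) * 0 := by
        rw [mul_zero, mul_add, mul_add, ← hp', ← hG', ← hS']; exact h
      have h3 : (v : AinfRam D) * T' * R + varpi D ^ (m1 + 1) * T' ^ p * G + varpi D ^ (m2 + 1) * T' ^ N * S = 0 :=
        mul_left_cancel₀ (pow_ne_zero _ (varpi_ne_zero D)) h1
      have h4 : varpi D ∣ (v : AinfRam D) * T' * R := by
        have h5 : (v : AinfRam D) * T' * R = -(varpi D ^ (m1 + 1) * T' ^ p * G + varpi D ^ (m2 + 1) * T' ^ N * S) := by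
          linear_combination h3
        rw [h5]
        refine (dvd_neg).2 (dvd_add ?_ ?_)
        · exact ((dvd_pow_self _ (Nat.succ_ne_zero m1)).mul_right _).mul_right _
        · exact ((dvd_pow_self _ (Nat.succ_ne_zero m2)).mul_right _).mul_right _
      have h6 : varpi D ∣ T' := by
        rw [mul_assoc] at h4
        exact (hR.dvd_mul_right).1 ((v.isUnit.dvd_mul_left).1 h4)
      obtain ⟨T'', rfl⟩ := h6
      exact ⟨T'', by ring⟩

/-- **Three-term `ϖ`-adic descent, conclusion**: `p·T·R + ϖ·T^p·G + T^N·S = 0`, `R`, `S` units, `e < p`, `e + 2 ≤ N` `⟹ T = 0`.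
[cite: FarguesFontaine2018, §2.2] -/
theorem eq_zero_of_three_term (hF : Function.Surjective (WittVector.fontaineTheta (integerC F) p))
    {T R G S : AinfRam D} (hR : IsUnit R) (hS : IsUnit S) (he : D.e < p) {N : ℕ} (hN : D.e + 2 ≤ N)
    (h : (p : AinfRam D) * T * R + varpi D * T ^ p * G + T ^ N * S = 0) : T = 0 :=
  eq_zero_of_forall_varpi_pow_dvd D (varpi_pow_dvd_of_three_term D hF hR hS he hN h)

end AinfRam

/-! ## §2 (L2″): `[p]T = 0 ⟹ T = 0` under the three-term shape, `e < p` -/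

namespace AinfRamTop

variable {D : EisensteinRoot F p hp} {hθ : Function.Surjective (WittVector.fontaineTheta (integerC F) p)}
  (W : WeierstrassCurve (EisensteinRoot.CoeffDisc D))

omit [IsAdicComplete (Ideal.span {(p : integerC F)}) (integerC F)] in
/-- The uniformizer `ϖ ∈ 𝒪_D` (class of `X`) on the discrete copy. [cite: SerreLocalFields1979, Ch. I §6 Prop. 18] -/
theorem algebraMap_coeffDisc_root :
    algebraMap (EisensteinRoot.CoeffDisc D) (AinfRamTop D) (EisensteinRoot.CoeffDisc.of D (AdjoinRoot.root D.poly)) =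
      of D (AinfRam.varpi D) := by
  rw [EisensteinRoot.algebraMap_coeffDisc_ainfRamTop, AinfRam.coeffHom_root]

/-- **`[p](a) = p·a·R(a) + ϖ·a^p·H(a) + a^{p²}·S(a)` on points of `𝔫_𝒪`**, for the three-term shape. [cite: SilvermanAEC2009, IV.4.4] -/
theorem coe_mulP_eq_of_three_term {R H S : PowerSeries (EisensteinRoot.CoeffDisc D)}
    (hshape : W.formalMul p = (p : PowerSeries (EisensteinRoot.CoeffDisc D)) * PowerSeries.X * R +
      PowerSeries.C (EisensteinRoot.CoeffDisc.of D (AdjoinRoot.root D.poly)) * PowerSeries.X ^ p * H + PowerSeries.X ^ (p ^ 2) * S)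
    (a : (nilTheta D hθ).toIdeal) :
    (mulP W a : AinfRamTop D) =
      (p : AinfRamTop D) * a * evalAt (nilTheta D hθ) a R +
        of D (AinfRam.varpi D) * (a : AinfRamTop D) ^ p * evalAt (nilTheta D hθ) a H +
        (a : AinfRamTop D) ^ (p ^ 2) * evalAt (nilTheta D hθ) a S := by
  rw [mulP, coe_evalPt₁_eq_evalAt, hshape, map_add, map_add, map_mul, map_mul, map_mul, map_mul, map_mul, map_pow, map_pow,
    map_natCast, evalAt_nilTheta_X, evalAt_nilTheta_C, algebraMap_coeffDisc_root]

/-- **(L2″) `[p]T = 0 ⟹ T = 0` on `Ŵ(𝔫_𝒪)` for the three-term supersingular shape over a tamely ramified base (`e < p`).**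
If `[p](X) = p·X·R + ϖ·X^p·H + X^{p²}·S` with `R(0), S(0) ∈ 𝒪_Dˣ`, `H` arbitrary, and `e < p`, then every `T ∈ Ŵ(𝔫_𝒪)` with
`[p]T = 0` vanishes. [cite: SilvermanAEC2009, IV.7.5] [cite: FarguesFontaine2018, §2.2] -/
theorem eq_zero_of_mulP_eq_zero_of_lt {R H S : PowerSeries (EisensteinRoot.CoeffDisc D)}
    (hshape : W.formalMul p = (p : PowerSeries (EisensteinRoot.CoeffDisc D)) * PowerSeries.X * R +
      PowerSeries.C (EisensteinRoot.CoeffDisc.of D (AdjoinRoot.root D.poly)) * PowerSeries.X ^ p * H + PowerSeries.X ^ (p ^ 2) * S)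
    (hR : IsUnit (PowerSeries.constantCoeff R)) (hS : IsUnit (PowerSeries.constantCoeff S)) (he : D.e < p)
    {T : (nilTheta D hθ).toIdeal} (hT : (mulP W T : AinfRamTop D) = 0) : (T : AinfRamTop D) = 0 := by
  have hp : p.Prime := Fact.out
  have hN : D.e + 2 ≤ p ^ 2 := by nlinarith [hp.two_le]
  have h1 := coe_mulP_eq_of_three_term W hshape T
  rw [hT] at h1
  exact AinfRam.eq_zero_of_three_term D hθ (T := (of D).symm T) (G := evalAt (nilTheta D hθ) T H)
    (isUnit_evalAt_of_isUnit_constantCoeff T hR) (isUnit_evalAt_of_isUnit_constantCoeff T hS) he hN h1.symm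

/-! ## §3 (N1″): `∫_t ω ≠ 0` when `t₁ ≠ 0`, three-term shape, `e < p` -/

/-- **(N1″) over a tamely ramified base**: if `[p]_W = p·X·R + ϖ·X^p·H + X^{p²}·S` with `R(0), S(0) ∈ 𝒪_Dˣ` and `e < p`, then for
every `[p]`-compatible sequence `t` of points of `Ŵ(𝔪_{ℂ_F})` with `t₀ = 0` and `t₁ ≠ 0`, the ω-period `∫_t ω = log_W(ι_𝒪[t])` is
NONZERO (`∫_t ω = 0 ⟹ [t] = 0 ⟹ [p][t⁺] = 0 ⟹ [t⁺] = 0 ⟹ t₁ = θ_𝒪([t⁺]) = 0`).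
[cite: Fontaine1982FormesDifferentielles, §5] [cite: SilvermanAEC2009, IV.7.5] -/
theorem omegaPeriod_ne_zero_of_seq_one_ne_zero_of_lt {R H S : PowerSeries (EisensteinRoot.CoeffDisc D)}
    (hshape : W.formalMul p = (p : PowerSeries (EisensteinRoot.CoeffDisc D)) * PowerSeries.X * R +
      PowerSeries.C (EisensteinRoot.CoeffDisc.of D (AdjoinRoot.root D.poly)) * PowerSeries.X ^ p * H + PowerSeries.X ^ (p ^ 2) * S)
    (hR : IsUnit (PowerSeries.constantCoeff R)) (hS : IsUnit (PowerSeries.constantCoeff S)) (he : D.e < p)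
    {t : ℕ → (maxNilIdealC F).toIdeal} (ht0 : (t 0 : CBall F) = 0) (htp : ∀ n, mulPC W (t (n + 1)) = t n)
    (h1 : (t 1 : CBall F) ≠ 0) : omegaPeriod W hθ t ht0 htp ≠ 0 := by
  intro h
  have hL1 : torsionLift W hθ t htp = 0 := torsionLift_eq_zero_of_omegaPeriod_eq_zero W ht0 htp h
  have hmul0 : (mulP W ⟨torsionLift W hθ (fun n => t (n + 1)) (mulPC_shift W htp), flim_mem_nilTheta _ _⟩ : AinfRamTop D) = 0 :=
    (mulP_torsionLift_shift W (hθ := hθ) htp).trans hL1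
  have hL2 : torsionLift W hθ (fun n => t (n + 1)) (mulPC_shift W htp) = 0 :=
    eq_zero_of_mulP_eq_zero_of_lt W hshape hR hS he hmul0
  have hθ1 : theta D (torsionLift W hθ (fun n => t (n + 1)) (mulPC_shift W htp)) = t (0 + 1) :=
    theta_torsionLift_eq W (hθ := hθ) (t := fun n => t (n + 1)) (mulPC_shift W htp)
  rw [hL2, map_zero, zero_add] at hθ1
  exact h1 hθ1.symm

end AinfRamTop

end Literature.NumberTheory.PAdicHodge

end
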